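import Literature.NumberTheory.Rogawski1990.Ch12Sec5Defs                              -- ★ TR carpet: `EllipticData`, `innerG` (the elliptic inner product, §12.5 p. 184)
import Summits.HodgeConjecture.HodgeConjecture.Theorems.F0P3cStCharTSEllAlg            -- ★ p848212 (this seat): «ELL-ALG»
import Mathlib.MeasureTheory.Function.L1Space.Integrable
import HarnessLib

/-!
# F0 · P3c · line LH6 «StCharTS» — BRICK «ELL-LIN» for organ (S-b1): the carpet's elliptic inner product `⟨ , ⟩_{G,e}` (★ `Ch12Sec5Defs.EllipticData.innerG`)
# is additive ∕ homogeneous in the first slot and additive ∕ conjugate-homogeneous in the second ON THE `L²(D_G)`-DOMAIN, hence satisfies «ELL-ALG»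

Cell `pub/hodgecm-mathlib`, crux H413 = `stmt-HodgeConjecture-24833` (`--supports` lane, helper), route HCCMUnconditional; seat LH6-p01 (g0); the «ELL» road of
desk F0P3b-plan (g23) (deal 2026-09-02T02:40:23Z; next step announced 02:44Z).  THEOREMS ONLY, sorry-free, no definition ∕ instance ∕ notation ∕ named fact; generic
over the TR carpet's posited datum `𝔇 : EllipticData G H` — nothing about `U(3)` is asserted.
HONEST LABEL: HC_CM is proved only modulo the 7 printed citations (2 remaining: hLiu418 = stmt-HodgeConjecture-24832, h413 = stmt-HodgeConjecture-24833)
until rung 0 closes; count-neutral measure theory.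

THE MATHEMATICS.  [Rogawski1990, §12.5 p. 184]: `⟨α₁, α₂⟩_{G,e} = Σ_T |Ω(T,G)|⁻¹ ∫_{Z\T} D_G(γ)² α₁(γ) \overline{α₂(γ)} dγ` over representatives `T` of the elliptic
Cartan subgroups, `meas(Z\T) = 1`; the carpet types it as `𝔇.innerG α₁ α₂ = Σ_{T ∈ 𝔇.cartanG} (weylOrder T)⁻¹ · ∫_{t ∈ T} (D_G t)²·α₁ t·conj(α₂ t) ∂(𝔇.μT T)`.  It is
sesquilinear wherever the integrals converge; the natural domain making EVERY pairing of members converge is «`D_G·α` square-integrable on each elliptic Cartan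
representative» (print: `D_G χ_π` is bounded on the elliptic set for `π` square-integrable, and `meas(Z\T) = 1`), since `(D_G² α₁ \overline{α₂}) = (D_G α₁)·\overline{(D_G α₂)}`
is then integrable by Cauchy–Schwarz (Mathlib `MemLp.integrable_mul`, `HolderConjugate 2 2`).
* §1 the domain `IsEllL2 𝔇 α := ∀ T ∈ 𝔇.cartanG, MemLp (t ↦ D_G(t)·α(t)) 2 (𝔇.μT T)` — written INLINE (no definition is introduced): closed under `0`, `+`, `c • ·`;
* §2 `innerG_add_left ∕ innerG_smul_left ∕ innerG_add_right ∕ innerG_smul_right` (conj on the second slot) on that domain;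
* §3 `finsum_sq_eq_of_innerG_self_eq` = ★ «ELL-ALG» `finsum_sq_eq_of_pairing_self_eq` read at `B := 𝔇.innerG`, `σ := starRingEnd ℂ`: for an `innerG`-ORTHONORMAL finite
  family in the domain with integer coefficients `aX`, `⟨χ, χ⟩_{G,e} = n ⇒ ∑ᶠ i, aX i ^ 2 = n` — the (S-b1) conclusion shape, leaving as inputs exactly the printed facts
  [orthogonality relations Prop. 12.6.1; `χ^G_ρ = Σ aX χ_π` on `G^e`; Prop. 12.5.2; `⟨χ_ρ, χ_ρ⟩_{H,e} = 1`].

## References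
* [Rogawski1990] J. D. Rogawski, *Automorphic Representations of Unitary Groups in Three Variables*, Ann. of Math. Stud. 123 (1990): §12.5 p. 184 (elliptic inner
  product); §12.6 Prop. 12.6.1 p. 188; §12.7 Lemma 12.7.2 (proof) p. 194.
* [DeitmarEchterhoff2014] A. Deitmar, S. Echterhoff, *Principles of Harmonic Analysis*, 2nd ed. (2014), Thm. 1.5.3 (Haar measure; here only Cauchy–Schwarz in `L²`).
-/

set_option autoImplicit false
-- the mandated namespace has the single-problem summit's repeated segment (`HodgeConjecture.HodgeConjecture`)
set_option linter.dupNamespace false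

noncomputable section

open MeasureTheory
open scoped BigOperators ENNReal

namespace Summit.HodgeConjecture.HodgeConjecture.Cruxes.H413.F0P3cStCharTSEllLin

open Literature.NumberTheory.Rogawski1990.Ch12Sec5 Literature.NumberTheory.Automorphic

variable {G H : Type} [Group G] [TopologicalSpace G] [IsTopologicalGroup G] [MeasurableSpace G]
  [∀ γ : G, MeasurableSpace (G ⧸ Subgroup.centralizer ({γ} : Set G))] [MeasurableSpace (G ⧸ Subgroup.center G)]
  [Group H] [TopologicalSpace H] [IsTopologicalGroup H] [MeasurableSpace H]
  (𝔇 : EllipticData G H)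

/-! ## §1 The `L²(D_G)` domain on the elliptic Cartan representatives: `0`, `+`, `•` -/

/-- `0` is in the domain. [cite: Rogawski1990, §12.5 p. 184] -/
theorem isEllL2_zero : ∀ T ∈ 𝔇.cartanG, MemLp (fun t : ↥T => (𝔇.DG (t : G) : ℂ) * (0 : G → ℂ) (t : G)) 2 (𝔇.μT T) := by
  intro T _
  simp only [Pi.zero_apply, mul_zero]
  exact MemLp.zero'

/-- The domain is closed under addition. [cite: Rogawski1990, §12.5 p. 184] -/
theorem isEllL2_add {α β : G → ℂ}
    (hα : ∀ T ∈ 𝔇.cartanG, MemLp (fun t : ↥T => (𝔇.DG (t : G) : ℂ) * α (t : G)) 2 (𝔇.μT T))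
    (hβ : ∀ T ∈ 𝔇.cartanG, MemLp (fun t : ↥T => (𝔇.DG (t : G) : ℂ) * β (t : G)) 2 (𝔇.μT T)) :
    ∀ T ∈ 𝔇.cartanG, MemLp (fun t : ↥T => (𝔇.DG (t : G) : ℂ) * (α + β) (t : G)) 2 (𝔇.μT T) := by
  intro T hT
  have h := (hα T hT).add (hβ T hT)
  refine h.congr_norm ((hα T hT).aestronglyMeasurable.add (hβ T hT).aestronglyMeasurable |>.congr ?_) ?_
  · exact Filter.Eventually.of_forall fun t => by simp only [Pi.add_apply, mul_add]
  · exact Filter.Eventually.of_forall fun t => by simp only [Pi.add_apply, mul_add]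

/-- The domain is closed under scalars. [cite: Rogawski1990, §12.5 p. 184] -/
theorem isEllL2_smul (c : ℂ) {α : G → ℂ}
    (hα : ∀ T ∈ 𝔇.cartanG, MemLp (fun t : ↥T => (𝔇.DG (t : G) : ℂ) * α (t : G)) 2 (𝔇.μT T)) :
    ∀ T ∈ 𝔇.cartanG, MemLp (fun t : ↥T => (𝔇.DG (t : G) : ℂ) * (c • α) (t : G)) 2 (𝔇.μT T) := by
  intro T hT
  have h := (hα T hT).const_mul c
  refine h.congr_norm (h.aestronglyMeasurable.congr ?_) ?_
  · exact Filter.Eventually.of_forall fun t => by simp only [Pi.smul_apply, smul_eq_mul]; ring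
  · exact Filter.Eventually.of_forall fun t => by simp only [Pi.smul_apply, smul_eq_mul]; ring_nf

/-! ## §2 Sesquilinearity of `⟨ , ⟩_{G,e}` on the domain -/

/-- The integrand of `⟨α₁, α₂⟩_{G,e}` on a Cartan representative is `(D_G α₁)·\overline{(D_G α₂)}` (as `D_G` is real), hence INTEGRABLE for `α₁, α₂` in the
`L²(D_G)` domain (Cauchy–Schwarz). [cite: Rogawski1990, §12.5 p. 184] -/
theorem integrable_innerG_integrand {α₁ α₂ : G → ℂ} {T : Subgroup G}
    (h₁ : MemLp (fun t : ↥T => (𝔇.DG (t : G) : ℂ) * α₁ (t : G)) 2 (𝔇.μT T))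
    (h₂ : MemLp (fun t : ↥T => (𝔇.DG (t : G) : ℂ) * α₂ (t : G)) 2 (𝔇.μT T)) :
    Integrable (fun t : ↥T => (𝔇.DG (t : G) : ℂ) ^ 2 * α₁ (t : G) * starRingEnd ℂ (α₂ (t : G))) (𝔇.μT T) := by
  have hprod : Integrable ((fun t : ↥T => (𝔇.DG (t : G) : ℂ) * α₁ (t : G)) * star (fun t : ↥T => (𝔇.DG (t : G) : ℂ) * α₂ (t : G))) (𝔇.μT T) :=
    h₁.integrable_mul h₂.star
  refine hprod.congr (Filter.Eventually.of_forall fun t => ?_)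
  simp only [Pi.mul_apply, Pi.star_apply, star_mul', Complex.star_def, Complex.conj_ofReal]
  ring

/-- **Additivity in the first slot** on the domain. [cite: Rogawski1990, §12.5 p. 184] -/
theorem innerG_add_left {α β γ : G → ℂ}
    (hα : ∀ T ∈ 𝔇.cartanG, MemLp (fun t : ↥T => (𝔇.DG (t : G) : ℂ) * α (t : G)) 2 (𝔇.μT T))
    (hβ : ∀ T ∈ 𝔇.cartanG, MemLp (fun t : ↥T => (𝔇.DG (t : G) : ℂ) * β (t : G)) 2 (𝔇.μT T))
    (hγ : ∀ T ∈ 𝔇.cartanG, MemLp (fun t : ↥T => (𝔇.DG (t : G) : ℂ) * γ (t : G)) 2 (𝔇.μT T)) :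
    𝔇.innerG (α + β) γ = 𝔇.innerG α γ + 𝔇.innerG β γ := by
  unfold EllipticData.innerG
  rw [← Finset.sum_add_distrib]
  refine Finset.sum_congr rfl fun T hT => ?_
  have hsplit : (∫ t : ↥T, (𝔇.DG (t : G) : ℂ) ^ 2 * (α + β) (t : G) * starRingEnd ℂ (γ (t : G)) ∂(𝔇.μT T)) =
      ∫ t : ↥T, ((𝔇.DG (t : G) : ℂ) ^ 2 * α (t : G) * starRingEnd ℂ (γ (t : G)) +
        (𝔇.DG (t : G) : ℂ) ^ 2 * β (t : G) * starRingEnd ℂ (γ (t : G))) ∂(𝔇.μT T) :=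
    integral_congr_ae (Filter.Eventually.of_forall fun t => by simp only [Pi.add_apply]; ring)
  rw [hsplit, integral_add (integrable_innerG_integrand 𝔇 (hα T hT) (hγ T hT)) (integrable_innerG_integrand 𝔇 (hβ T hT) (hγ T hT)), mul_add]

/-- **Homogeneity in the first slot** (unconditional: `∫ c·F = c·∫ F` holds for every `F`, junk values included). [cite: Rogawski1990, §12.5 p. 184] -/
theorem innerG_smul_left (c : ℂ) (α γ : G → ℂ) :
    𝔇.innerG (c • α) γ = c * 𝔇.innerG α γ := by
  unfold EllipticData.innerG
  rw [Finset.mul_sum]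
  refine Finset.sum_congr rfl fun T _ => ?_
  have hsplit : (∫ t : ↥T, (𝔇.DG (t : G) : ℂ) ^ 2 * (c • α) (t : G) * starRingEnd ℂ (γ (t : G)) ∂(𝔇.μT T)) =
      ∫ t : ↥T, c * ((𝔇.DG (t : G) : ℂ) ^ 2 * α (t : G) * starRingEnd ℂ (γ (t : G))) ∂(𝔇.μT T) :=
    integral_congr_ae (Filter.Eventually.of_forall fun t => by simp only [Pi.smul_apply, smul_eq_mul]; ring)
  rw [hsplit, integral_const_mul, mul_left_comm]

/-- **Additivity in the second slot** on the domain. [cite: Rogawski1990, §12.5 p. 184] -/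
theorem innerG_add_right {α β γ : G → ℂ}
    (hα : ∀ T ∈ 𝔇.cartanG, MemLp (fun t : ↥T => (𝔇.DG (t : G) : ℂ) * α (t : G)) 2 (𝔇.μT T))
    (hβ : ∀ T ∈ 𝔇.cartanG, MemLp (fun t : ↥T => (𝔇.DG (t : G) : ℂ) * β (t : G)) 2 (𝔇.μT T))
    (hγ : ∀ T ∈ 𝔇.cartanG, MemLp (fun t : ↥T => (𝔇.DG (t : G) : ℂ) * γ (t : G)) 2 (𝔇.μT T)) :
    𝔇.innerG α (β + γ) = 𝔇.innerG α β + 𝔇.innerG α γ := by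
  unfold EllipticData.innerG
  rw [← Finset.sum_add_distrib]
  refine Finset.sum_congr rfl fun T hT => ?_
  have hsplit : (∫ t : ↥T, (𝔇.DG (t : G) : ℂ) ^ 2 * α (t : G) * starRingEnd ℂ ((β + γ) (t : G)) ∂(𝔇.μT T)) =
      ∫ t : ↥T, ((𝔇.DG (t : G) : ℂ) ^ 2 * α (t : G) * starRingEnd ℂ (β (t : G)) +
        (𝔇.DG (t : G) : ℂ) ^ 2 * α (t : G) * starRingEnd ℂ (γ (t : G))) ∂(𝔇.μT T) :=
    integral_congr_ae (Filter.Eventually.of_forall fun t => by simp only [Pi.add_apply, map_add]; ring)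
  rw [hsplit, integral_add (integrable_innerG_integrand 𝔇 (hα T hT) (hβ T hT)) (integrable_innerG_integrand 𝔇 (hα T hT) (hγ T hT)), mul_add]

/-- **Conjugate-homogeneity in the second slot** (unconditional; `σ = starRingEnd ℂ` in «ELL-ALG»). [cite: Rogawski1990, §12.5 p. 184] -/
theorem innerG_smul_right (c : ℂ) (α γ : G → ℂ) :
    𝔇.innerG α (c • γ) = starRingEnd ℂ c * 𝔇.innerG α γ := by
  unfold EllipticData.innerG
  rw [Finset.mul_sum]
  refine Finset.sum_congr rfl fun T _ => ?_
  have hsplit : (∫ t : ↥T, (𝔇.DG (t : G) : ℂ) ^ 2 * α (t : G) * starRingEnd ℂ ((c • γ) (t : G)) ∂(𝔇.μT T)) =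
      ∫ t : ↥T, starRingEnd ℂ c * ((𝔇.DG (t : G) : ℂ) ^ 2 * α (t : G) * starRingEnd ℂ (γ (t : G))) ∂(𝔇.μT T) :=
    integral_congr_ae (Filter.Eventually.of_forall fun t => by simp only [Pi.smul_apply, smul_eq_mul, map_mul]; ring)
  rw [hsplit, integral_const_mul, mul_left_comm]

/-! ## §3 «ELL-ALG» read at `⟨ , ⟩_{G,e}`: the (S-b1) conclusion shape -/

/-- **`⟨χ, χ⟩_{G,e} = n ⇒ ∑ᶠ i, aX i ^ 2 = n` for an `⟨ , ⟩_{G,e}`-ORTHONORMAL finite family in the `L²(D_G)` domain with integer coefficients** (★ «ELL-ALG»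
`finsum_sq_eq_of_pairing_self_eq` at `B := 𝔇.innerG`, `σ := starRingEnd ℂ`, domain = §1).  For (S-b1): `χ i := 𝔇.char π_i` (the members of `supp aX`), orthonormality from
the orthogonality relations [Prop. 12.6.1] (+ no l.d.s. pair among the members), and `n = 2` from `χ = χ^G_ρ` on `G^e`, Prop. 12.5.2 and `⟨χ_ρ, χ_ρ⟩_{H,e} = 1`.
[cite: Rogawski1990, §12.7 Lemma 12.7.2 (proof) p. 194; §12.6 Prop. 12.6.1 p. 188; Prop. 12.5.2 p. 185] -/
theorem finsum_sq_eq_of_innerG_self_eq {ι : Type*} [DecidableEq ι] (aX : ι → ℤ) (hfin : (Function.support aX).Finite) (χ : ι → (G → ℂ))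
    (hχ : ∀ i ∈ hfin.toFinset, ∀ T ∈ 𝔇.cartanG, MemLp (fun t : ↥T => (𝔇.DG (t : G) : ℂ) * χ i (t : G)) 2 (𝔇.μT T))
    (horth : ∀ i ∈ hfin.toFinset, ∀ j ∈ hfin.toFinset, 𝔇.innerG (χ i) (χ j) = if i = j then 1 else 0) (n : ℤ)
    (hB : 𝔇.innerG (∑ i ∈ hfin.toFinset, (aX i : ℂ) • χ i) (∑ j ∈ hfin.toFinset, (aX j : ℂ) • χ j) = n) :
    ∑ᶠ i, aX i ^ 2 = n :=
  F0P3cStCharTSEllAlg.finsum_sq_eq_of_pairing_self_eq (starRingEnd ℂ)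
    (fun α : G → ℂ => ∀ T ∈ 𝔇.cartanG, MemLp (fun t : ↥T => (𝔇.DG (t : G) : ℂ) * α (t : G)) 2 (𝔇.μT T)) 𝔇.innerG
    (isEllL2_zero 𝔇) (fun _ _ hx hy => isEllL2_add 𝔇 hx hy) (fun c _ hx => isEllL2_smul 𝔇 c hx)
    (fun _ _ _ hx hy hz => innerG_add_left 𝔇 hx hy hz) (fun c x z _ _ => innerG_smul_left 𝔇 c x z)
    (fun _ _ _ hx hy hz => innerG_add_right 𝔇 hx hy hz) (fun c x z _ _ => innerG_smul_right 𝔇 c x z)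
    aX hfin χ hχ horth n hB

/-! ## §4 `⟨ , ⟩_{G,e}` only sees the values on the elliptic Cartan representatives (a.e.): congruence lemmas, and (S-b1)'s shape from an a.e. identity
`Σ aX(π) χ_π = χ^G_ρ` on them (appended 2026-09-02, same seat, «ELL-NORM2») -/

/-- **`⟨α, β⟩_{G,e}` depends on `α` only through its values `μT`-a.e. on the representatives `T ∈ cartanG`** (the integrals are over those tori).
[cite: Rogawski1990, §12.5 p. 184] -/
theorem innerG_congr_left {α α' : G → ℂ} (β : G → ℂ)
    (h : ∀ T ∈ 𝔇.cartanG, ∀ᵐ t : ↥T ∂(𝔇.μT T), α (t : G) = α' (t : G)) :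
    𝔇.innerG α β = 𝔇.innerG α' β := by
  unfold EllipticData.innerG
  refine Finset.sum_congr rfl fun T hT => ?_
  congr 1
  refine integral_congr_ae ((h T hT).mono fun t ht => ?_)
  simp only [ht]

/-- **`⟨α, β⟩_{G,e}` depends on `β` only through its values `μT`-a.e. on the representatives `T ∈ cartanG`.** [cite: Rogawski1990, §12.5 p. 184] -/
theorem innerG_congr_right (α : G → ℂ) {β β' : G → ℂ}
    (h : ∀ T ∈ 𝔇.cartanG, ∀ᵐ t : ↥T ∂(𝔇.μT T), β (t : G) = β' (t : G)) :
    𝔇.innerG α β = 𝔇.innerG α β' := by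
  unfold EllipticData.innerG
  refine Finset.sum_congr rfl fun T hT => ?_
  congr 1
  refine integral_congr_ae ((h T hT).mono fun t ht => ?_)
  simp only [ht]

/-- Both slots at once: `α = α′` a.e. on the elliptic Cartan representatives ⇒ `⟨α, α⟩_{G,e} = ⟨α′, α′⟩_{G,e}`. [cite: Rogawski1990, §12.5 p. 184] -/
theorem innerG_self_congr {α α' : G → ℂ}
    (h : ∀ T ∈ 𝔇.cartanG, ∀ᵐ t : ↥T ∂(𝔇.μT T), α (t : G) = α' (t : G)) :
    𝔇.innerG α α = 𝔇.innerG α' α' := by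
  rw [innerG_congr_left 𝔇 α h, innerG_congr_right 𝔇 α' h]

/-- **(S-b1)'s shape from the printed inputs, algebra discharged**: an `⟨ , ⟩_{G,e}`-orthonormal finite family `χ_i` in the `L²(D_G)` domain, integer coefficients
`aX`, and a class function `ψ` (print: `χ^G_ρ`) with `Σ_{i ∈ supp aX} aX(i)·χ_i = ψ` a.e. on every elliptic Cartan representative (print: the (β)-identity read
through Harish-Chandra's characters-as-functions and `UpSpec`) and `⟨ψ, ψ⟩_{G,e} = n` (print: `= 2⟨χ_ρ, χ_ρ⟩_{H,e} = 2`, Prop. 12.5.2): then `∑ᶠ i, aX i ^ 2 = n`.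
[cite: Rogawski1990, §12.7 Lemma 12.7.2 (proof) p. 194; Prop. 12.5.2 p. 185; §12.6 Prop. 12.6.1 p. 188] -/
theorem finsum_sq_eq_of_sum_ae_eq_of_innerG_eq {ι : Type*} [DecidableEq ι] (aX : ι → ℤ) (hfin : (Function.support aX).Finite) (χ : ι → (G → ℂ))
    (hχ : ∀ i ∈ hfin.toFinset, ∀ T ∈ 𝔇.cartanG, MemLp (fun t : ↥T => (𝔇.DG (t : G) : ℂ) * χ i (t : G)) 2 (𝔇.μT T))
    (horth : ∀ i ∈ hfin.toFinset, ∀ j ∈ hfin.toFinset, 𝔇.innerG (χ i) (χ j) = if i = j then 1 else 0)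
    (ψ : G → ℂ) (hψ : ∀ T ∈ 𝔇.cartanG, ∀ᵐ t : ↥T ∂(𝔇.μT T), (∑ i ∈ hfin.toFinset, (aX i : ℂ) • χ i) (t : G) = ψ (t : G))
    (n : ℤ) (hn : 𝔇.innerG ψ ψ = n) :
    ∑ᶠ i, aX i ^ 2 = n :=
  finsum_sq_eq_of_innerG_self_eq 𝔇 aX hfin χ hχ horth n (by rw [innerG_self_congr 𝔇 hψ, hn])

end Summit.HodgeConjecture.HodgeConjecture.Cruxes.H413.F0P3cStCharTSEllLin
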